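import Summits.BirchSwinnertonDyer.BirchSwinnertonDyer.Theorems.ManinLocalTwoThreeGaussianSqueezeThirtyTwo
import Summits.BirchSwinnertonDyer.BirchSwinnertonDyer.Theorems.ManinLocalTwoThreeEtaIdentityReductionTwentySeven
import HarnessLib

/-!
# Level 32: reduction of the `η`-identities to three `q`-asymptotics (T1)₃₂–(T3)₃₂ at `i∞` (cell bsd-f2-manin, -an g49 §94.8)

Planner file `HOME/an/g49/Sketch-an-g49d.lean` (90a7b65ce0a66af2) landed definition-free, with the composed
headline.  Port of `EtaIdentityReductionTwentySeven` (level 27) to level 32.  Objects (tree `etaQuotient 32 r`):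

* `X₃₂ = η(16τ)⁶/(η(8τ)²η(32τ)⁴) = q⁻²(1 + 2q⁸ − …)`  (`r = expFn [(8,-2),(16,6),(32,-4)]`, the `x`-coordinate
  of `X₀(32) → 32a1 : y² = x³ + 4x`),
* `Y₃₂ = η(8τ)⁴η(16τ)²/(η(4τ)²η(32τ)⁴) = q⁻³(1 + 2q⁴ + …)`  (`r = expFn [(4,-2),(8,4),(16,2),(32,-4)]`),
* `φ₃₂ = η(4τ)²η(8τ)²` (`cuspFormEtaProductThirtyTwo`), invariants `g₂ = −16`, `g₃ = 0`.

(T1)₃₂ `((2πi)⁻¹X′ + φ₃₂·2Y)/q → 0`; (T2)₃₂ `((2πi)⁻¹Y′ + φ₃₂·(3X² + 4))/q → 0`; (T3)₃₂ `X³ + 4X − Y² → 0`.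
The weight-2 combinations are cusp forms on `Γ₀(32)` (`dim S₂(Γ₀(32)) = 1`, `φ₃₂/q → 1`) and the cubic has zero
derivative, so the limits give the identities `X′ = −4πiφ₃₂Y`, `Y′ = −2πiφ₃₂(3X² + 4)`, `X³ + 4X = Y²`, hence
(S2)₃₂ `Λ(φ₃₂) ⊆ Λ(−16, 0)` (`AnalyticBridge.periodLattice_le_of_deriv_sq`) and, by the Gaussian squeeze,
`|c(D)| = 1` on `X₀(32)` (`abs_maninConstant_eq_one_thirtyTwo_of_tendsto`).  The three limits themselves need only
`∏(1 − q^{4n}) ≡ 1 − q⁴`, `∏(1 − q^{8n}) ≡ ∏(1 − q^{16n}) ≡ ∏(1 − q^{32n}) ≡ 1 (mod q⁸)`; not proved here.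
BSD is not proved by this.
-/

set_option autoImplicit false
set_option linter.dupNamespace false

noncomputable section

open Complex Filter Topology Set Function Asymptotics
open UpperHalfPlane hiding I
open scoped Real Topology Manifold MatrixGroups ModularForm
open ModularForm CongruenceSubgroup
open Literature.NumberTheory.EllipticCurves Literature.NumberTheory.EllipticCurves.ModularForms
open Summit.BirchSwinnertonDyer.BirchSwinnertonDyer.Theorems.ManinLocalTwoThree

namespace Summit.BirchSwinnertonDyer.BirchSwinnertonDyer.Theorems.ManinLocalTwoThree.EtaIdentityReductionThirtyTwo

open CuspToolkit AnalyticBridge EtaIdentityReduction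

/-! ## 1. Level-32 toolkit: `S ∈ S₂(Γ₀(32))` with `S/q → 0` vanishes -/

/-- **`S ∈ S₂(Γ₀(32))` with `S(τ)/q → 0` at `i∞` is zero** (`S₂(Γ₀(32)) = ℂ·φ₃₂`). [folklore] -/
theorem cuspForm_thirtyTwo_eq_zero_of_tendsto (S : CuspForm (Gamma0 32) 2)
    (h : Tendsto (fun τ : ℍ ↦ S τ / Function.Periodic.qParam 1 (τ : ℂ)) atImInfty (𝓝 0)) :
    S = 0 := by
  obtain ⟨c, hc⟩ := finrank_cuspForm_two_eq_genusX0_thirtyTwo.2.2 S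
  have hlim : Tendsto (fun τ : ℍ ↦ S τ / Function.Periodic.qParam 1 (τ : ℂ)) atImInfty (𝓝 c) := by
    have := GaussStableThirtyTwo.tendsto_etaProductThirtyTwo_div_qParam.const_mul c
    rw [mul_one] at this
    refine this.congr fun τ ↦ ?_
    rw [← hc, CuspForm.IsGLPos.smul_apply, smul_eq_mul, mul_div_assoc]
  have hc0 : c = 0 := tendsto_nhds_unique hlim h
  rw [← hc, hc0, zero_smul]

/-! ## 2. The weight-2 combination `R = (2πi)⁻¹ x′ + φ₃₂ y` is a cusp form on `Γ₀(32)` -/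

/-- `(R|₂A)(τ) = (2πi)⁻¹ (x∘A)′(τ) + (φ₃₂|₂A)(τ) · y(Aτ)`. [folklore] -/
theorem slash_two_apply32 {x : ℍ → ℂ} (y : ℍ → ℂ) (hx : MDifferentiable 𝓘(ℂ) 𝓘(ℂ) x) (A : SL(2, ℤ))
    (τ : ℍ) :
    ((fun σ : ℍ ↦ (2 * π * I)⁻¹ * deriv (x ∘ ofComplex) σ + cuspFormEtaProductThirtyTwo σ * y σ)
        ∣[(2 : ℤ)] A) τ
      = (2 * π * I)⁻¹ * deriv ((fun σ : ℍ ↦ x (A • σ)) ∘ ofComplex) τ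
        + (⇑cuspFormEtaProductThirtyTwo ∣[(2 : ℤ)] A) τ * y (A • τ) := by
  rw [SL_slash_apply, SL_slash_apply, ModularGroup.denom_apply, deriv_comp_smul_ofComplex hx A τ]
  have hJ : ((A 1 0 : ℤ) : ℂ) * (τ : ℂ) + ((A 1 1 : ℤ) : ℂ) ≠ 0 := SL2_denom_ne_zero A τ
  rw [zpow_neg, zpow_ofNat]
  field_simp

/-- `R = (2πi)⁻¹x′ + φ₃₂y` IS A CUSP FORM on `Γ₀(32)` when `x, y` are holomorphic and `Γ₀(32)`-invariant,
`x∘γ`, `y∘γ` are bounded at `i∞` off `Γ₀(32)`, and `R → 0` at `i∞`. [folklore] -/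
theorem exists_cuspForm32 (x y : ℍ → ℂ) (hx : MDifferentiable 𝓘(ℂ) 𝓘(ℂ) x)
    (hy : MDifferentiable 𝓘(ℂ) 𝓘(ℂ) y)
    (hxinv : ∀ γ : SL(2, ℤ), γ ∈ Gamma0 32 → ∀ τ : ℍ, x (γ • τ) = x τ)
    (hyinv : ∀ γ : SL(2, ℤ), γ ∈ Gamma0 32 → ∀ τ : ℍ, y (γ • τ) = y τ)
    (hxb : ∀ γ : SL(2, ℤ), γ ∉ Gamma0 32 → IsBoundedAtImInfty (fun τ : ℍ ↦ x (γ • τ)))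
    (hyb : ∀ γ : SL(2, ℤ), γ ∉ Gamma0 32 → IsBoundedAtImInfty (fun τ : ℍ ↦ y (γ • τ)))
    (h0 : IsZeroAtImInfty
      (fun σ : ℍ ↦ (2 * π * I)⁻¹ * deriv (x ∘ ofComplex) σ + cuspFormEtaProductThirtyTwo σ * y σ)) :
    ∃ S : CuspForm (Gamma0 32) 2, ∀ τ : ℍ,
      S τ = (2 * π * I)⁻¹ * deriv (x ∘ ofComplex) τ + cuspFormEtaProductThirtyTwo τ * y τ := by
  have hdiffx := UpperHalfPlane.mdifferentiable_iff.mp hx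
  have hφinv : ∀ γ : SL(2, ℤ), γ ∈ Gamma0 32 →
      (⇑cuspFormEtaProductThirtyTwo ∣[(2 : ℤ)] γ) = ⇑cuspFormEtaProductThirtyTwo := fun γ hγ ↦ by
    have h := SlashInvariantForm.slash_action_eqn cuspFormEtaProductThirtyTwo _ ⟨γ, hγ, rfl⟩
    rw [SL_slash]
    exact h
  refine ⟨{ toFun := fun σ : ℍ ↦ (2 * π * I)⁻¹ * deriv (x ∘ ofComplex) σ
              + cuspFormEtaProductThirtyTwo σ * y σ
            slash_action_eq' := ?_
            holo' := ?_
            zero_at_cusps' := ?_ }, fun τ ↦ rfl⟩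
  · intro A hA
    obtain ⟨γ, hγ, rfl⟩ := hA
    funext τ
    show ((fun σ : ℍ ↦ (2 * π * I)⁻¹ * deriv (x ∘ ofComplex) σ
      + cuspFormEtaProductThirtyTwo σ * y σ) ∣[(2 : ℤ)] γ) τ = _
    rw [slash_two_apply32 y hx γ τ, hφinv γ hγ, hyinv γ hγ τ,
      show (fun σ : ℍ ↦ x (γ • σ)) = x from funext (hxinv γ hγ)]
  · rw [UpperHalfPlane.mdifferentiable_iff]
    have hD : DifferentiableOn ℂ (deriv (x ∘ ofComplex)) {z : ℂ | 0 < z.im} :=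
      (hdiffx.analyticOnNhd isOpen_upperHalfPlaneSet).deriv.differentiableOn
    have hφ := UpperHalfPlane.mdifferentiable_iff.mp (CuspFormClass.holo cuspFormEtaProductThirtyTwo)
    have hy' := UpperHalfPlane.mdifferentiable_iff.mp hy
    have h : DifferentiableOn ℂ (fun z : ℂ ↦ (2 * π * I)⁻¹ * deriv (x ∘ ofComplex) z
        + (cuspFormEtaProductThirtyTwo ∘ ofComplex) z * (y ∘ ofComplex) z) {z : ℂ | 0 < z.im} :=
      (hD.const_mul _).add (hφ.mul hy')
    refine h.congr fun z hz ↦ ?_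
    simp only [Function.comp_apply, ofComplex_apply_of_im_pos hz]
    rfl
  · intro c hc
    rw [Subgroup.IsArithmetic.isCusp_iff_isCusp_SL2Z] at hc
    rw [OnePoint.isZeroAt_iff_forall_SL2Z hc]
    intro A _
    show IsZeroAtImInfty ((fun σ : ℍ ↦ (2 * π * I)⁻¹ * deriv (x ∘ ofComplex) σ
      + cuspFormEtaProductThirtyTwo σ * y σ) ∣[(2 : ℤ)] A)
    have hfun : ((fun σ : ℍ ↦ (2 * π * I)⁻¹ * deriv (x ∘ ofComplex) σ
        + cuspFormEtaProductThirtyTwo σ * y σ) ∣[(2 : ℤ)] A)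
        = fun τ : ℍ ↦ (2 * π * I)⁻¹ * deriv ((fun σ : ℍ ↦ x (A • σ)) ∘ ofComplex) τ
          + (⇑cuspFormEtaProductThirtyTwo ∣[(2 : ℤ)] A) τ * y (A • τ) :=
      funext (slash_two_apply32 y hx A)
    rw [hfun]
    by_cases hA : A ∈ Gamma0 32
    · have hxA : (fun σ : ℍ ↦ x (A • σ)) = x := funext (hxinv A hA)
      simp_rw [hxA, hφinv A hA, hyinv A hA]
      exact h0
    · have h1 : IsZeroAtImInfty (fun τ : ℍ ↦ deriv ((fun σ : ℍ ↦ x (A • σ)) ∘ ofComplex) τ) :=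
        isZeroAtImInfty_deriv_of_isBoundedAtImInfty (CuspToolkit.mdifferentiable_comp_smul hx A) (hxb A hA)
      have h2 : IsZeroAtImInfty (⇑cuspFormEtaProductThirtyTwo ∣[(2 : ℤ)] A) :=
        CuspFormClass.zero_at_infty_slash cuspFormEtaProductThirtyTwo A
      have h3 : IsZeroAtImInfty
          (fun τ : ℍ ↦ (⇑cuspFormEtaProductThirtyTwo ∣[(2 : ℤ)] A) τ * y (A • τ)) :=
        h2.mul_boundedAtFilter (hyb A hA)
      have h4 : IsZeroAtImInfty
          (fun τ : ℍ ↦ (2 * π * I)⁻¹ * deriv ((fun σ : ℍ ↦ x (A • σ)) ∘ ofComplex) τ) :=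
        (const_boundedAtFilter atImInfty ((2 * π * I)⁻¹ : ℂ)).mul_zeroAtFilter h1
      exact h4.add h3

/-- **The cusp-form argument at level 32**: `((2πi)⁻¹x′ + φ₃₂y)/q → 0` at `i∞` ⟹ `x′ = −2πi φ₃₂ y` on `ℍ`.
[folklore] -/
theorem deriv_eq_of_tendsto32 (x y : ℍ → ℂ) (hx : MDifferentiable 𝓘(ℂ) 𝓘(ℂ) x)
    (hy : MDifferentiable 𝓘(ℂ) 𝓘(ℂ) y)
    (hxinv : ∀ γ : SL(2, ℤ), γ ∈ Gamma0 32 → ∀ τ : ℍ, x (γ • τ) = x τ)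
    (hyinv : ∀ γ : SL(2, ℤ), γ ∈ Gamma0 32 → ∀ τ : ℍ, y (γ • τ) = y τ)
    (hxb : ∀ γ : SL(2, ℤ), γ ∉ Gamma0 32 → IsBoundedAtImInfty (fun τ : ℍ ↦ x (γ • τ)))
    (hyb : ∀ γ : SL(2, ℤ), γ ∉ Gamma0 32 → IsBoundedAtImInfty (fun τ : ℍ ↦ y (γ • τ)))
    (hlim : Tendsto (fun τ : ℍ ↦ ((2 * π * I)⁻¹ * deriv (x ∘ ofComplex) τ
      + cuspFormEtaProductThirtyTwo τ * y τ) / Function.Periodic.qParam 1 (τ : ℂ)) atImInfty (𝓝 0)) :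
    ∀ τ : ℍ, deriv (x ∘ ofComplex) τ = -(2 * π * I * cuspFormEtaProductThirtyTwo τ) * y τ := by
  obtain ⟨S, hS⟩ := exists_cuspForm32 x y hx hy hxinv hyinv hxb hyb
    (isZeroAtImInfty_of_tendsto_div_qParam hlim)
  have hS0 : S = 0 := by
    refine cuspForm_thirtyTwo_eq_zero_of_tendsto S (hlim.congr fun τ ↦ ?_)
    rw [hS τ]
  intro τ
  have h := hS τ
  rw [hS0, CuspForm.zero_apply] at h
  have h2pi : (2 * π * I : ℂ) ≠ 0 := by simp [Real.pi_ne_zero, I_ne_zero]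
  have h' : deriv (x ∘ ofComplex) τ
      = (2 * π * I) * ((2 * π * I)⁻¹ * deriv (x ∘ ofComplex) τ
        + cuspFormEtaProductThirtyTwo τ * y τ) - 2 * π * I * cuspFormEtaProductThirtyTwo τ * y τ := by
    field_simp
    ring
  rw [h', ← h]
  ring

/-! ## 3. `X₃₂`, `Y₃₂` are invariant and bounded at every cusp off `∞` -/

/-- Newman's conditions for `X₃₂` (`∏ δ^{|r|} = 2⁵⁰`). [folklore] -/
theorem newmanCond_rX : NewmanCond 32 (expFn [(8, -2), (16, 6), (32, -4)]) 0 := ⟨by decide, by decide, by decide, ⟨2 ^ 25, by decide⟩⟩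

/-- Newman's conditions for `Y₃₂` (`∏ δ^{|r|} = 4²·8⁴·16²·32⁴ = 2⁴⁴ = (2²²)²`). [folklore] -/
theorem newmanCond_rY : NewmanCond 32 (expFn [(4, -2), (8, 4), (16, 2), (32, -4)]) 0 := ⟨by decide, by decide, by decide, ⟨2 ^ 22, by decide⟩⟩

/-- `X₃₂` is `Γ₀(32)`-invariant. [folklore] -/
theorem X_smul (γ : Gamma0 32) (τ : ℍ) : etaQuotient 32 (expFn [(8, -2), (16, 6), (32, -4)]) ((γ : SL(2, ℤ)) • τ) = etaQuotient 32 (expFn [(8, -2), (16, 6), (32, -4)]) τ := by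
  simpa using etaQuotient_smul_of_mem_Gamma0 32 (by norm_num) (expFn [(8, -2), (16, 6), (32, -4)]) 0 Even.zero newmanCond_rX γ.2 τ

/-- `Y₃₂` is `Γ₀(32)`-invariant. [folklore] -/
theorem Y_smul (γ : Gamma0 32) (τ : ℍ) : etaQuotient 32 (expFn [(4, -2), (8, 4), (16, 2), (32, -4)]) ((γ : SL(2, ℤ)) • τ) = etaQuotient 32 (expFn [(4, -2), (8, 4), (16, 2), (32, -4)]) τ := by
  simpa using etaQuotient_smul_of_mem_Gamma0 32 (by norm_num) (expFn [(4, -2), (8, 4), (16, 2), (32, -4)]) 0 Even.zero newmanCond_rY γ.2 τ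

/-- Ligozat's order is `≥ 0` at every `c` with `32 ∤ c`, given the values at `gcd(c, 32) ∈ {1,2,4,8,16}`. [folklore] -/
theorem cuspOrder24_nonneg_of_not_dvd32 (r : ℕ → ℤ) (h1 : 0 ≤ cuspOrder24 32 r 1)
    (h2 : 0 ≤ cuspOrder24 32 r 2) (h4 : 0 ≤ cuspOrder24 32 r 4) (h8 : 0 ≤ cuspOrder24 32 r 8)
    (h16 : 0 ≤ cuspOrder24 32 r 16) {c : ℤ} (hc : ¬ (32 : ℤ) ∣ c) :
    0 ≤ cuspOrder24 32 r c := by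
  rw [cuspOrder24_eq_gcd]
  have hdvd : Nat.gcd 32 c.natAbs ∣ 32 := Nat.gcd_dvd_left _ _
  have hne : Nat.gcd 32 c.natAbs ≠ 32 := by
    intro h
    apply hc
    have h32 : (32 : ℕ) ∣ c.natAbs := h ▸ Nat.gcd_dvd_right _ _
    exact Int.natCast_dvd.mpr h32
  have hmem : Nat.gcd 32 c.natAbs ∈ Nat.divisors 32 := Nat.mem_divisors.mpr ⟨hdvd, by norm_num⟩
  rw [show Nat.divisors 32 = {1, 2, 4, 8, 16, 32} by decide] at hmem
  simp only [Finset.mem_insert, Finset.mem_singleton] at hmem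
  rcases hmem with h | h | h | h | h | h
  · rw [h]; exact_mod_cast h1
  · rw [h]; exact_mod_cast h2
  · rw [h]; exact_mod_cast h4
  · rw [h]; exact_mod_cast h8
  · rw [h]; exact_mod_cast h16
  · exact absurd h hne

/-- `γ ∉ Γ₀(32)` ⟹ `32 ∤ c(γ)`. [folklore] -/
theorem not_dvd_of_not_mem32 {γ : SL(2, ℤ)} (hγ : γ ∉ Gamma0 32) : ¬ (32 : ℤ) ∣ γ 1 0 := by
  intro h
  apply hγ
  rw [Gamma0_mem]
  exact (ZMod.intCast_zmod_eq_zero_iff_dvd _ 32).mpr h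

/-- `X₃₂ ∘ γ` is bounded at `i∞` for `γ ∉ Γ₀(32)` (Ligozat orders `0,0,0,0,1536`). [folklore] -/
theorem isBoundedAtImInfty_X_smul {γ : SL(2, ℤ)} (hγ : γ ∉ Gamma0 32) :
    IsBoundedAtImInfty (fun τ : ℍ ↦ etaQuotient 32 (expFn [(8, -2), (16, 6), (32, -4)]) (γ • τ)) :=
  isBoundedAtImInfty_etaQuotient_smul 32 (by norm_num) _ (by decide) γ
    (cuspOrder24_nonneg_of_not_dvd32 _ (by decide) (by decide) (by decide) (by decide) (by decide)
      (not_dvd_of_not_mem32 hγ))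

/-- `Y₃₂ ∘ γ` is bounded at `i∞` for `γ ∉ Γ₀(32)` (Ligozat orders `0,0,0,768,768`). [folklore] -/
theorem isBoundedAtImInfty_Y_smul {γ : SL(2, ℤ)} (hγ : γ ∉ Gamma0 32) :
    IsBoundedAtImInfty (fun τ : ℍ ↦ etaQuotient 32 (expFn [(4, -2), (8, 4), (16, 2), (32, -4)]) (γ • τ)) :=
  isBoundedAtImInfty_etaQuotient_smul 32 (by norm_num) _ (by decide) γ
    (cuspOrder24_nonneg_of_not_dvd32 _ (by decide) (by decide) (by decide) (by decide) (by decide)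
      (not_dvd_of_not_mem32 hγ))

/-! ## 4. The three limits ⟹ the identities ⟹ (S2)₃₂ -/

/-- **(I2a)₃₂ from (T1)₃₂**: `X′ = −2πi φ₃₂ · 2Y`. [folklore] -/
theorem deriv_X_of_tendsto
    (hT1 : Tendsto (fun τ : ℍ ↦ ((2 * π * I)⁻¹ * deriv (etaQuotient 32 (expFn [(8, -2), (16, 6), (32, -4)]) ∘ ofComplex) τ
      + cuspFormEtaProductThirtyTwo τ * (2 * etaQuotient 32 (expFn [(4, -2), (8, 4), (16, 2), (32, -4)]) τ))
      / Function.Periodic.qParam 1 (τ : ℂ)) atImInfty (𝓝 0)) :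
    ∀ τ : ℍ, deriv (etaQuotient 32 (expFn [(8, -2), (16, 6), (32, -4)]) ∘ ofComplex) τ
      = -(2 * π * I * cuspFormEtaProductThirtyTwo τ) * (2 * etaQuotient 32 (expFn [(4, -2), (8, 4), (16, 2), (32, -4)]) τ) := by
  refine deriv_eq_of_tendsto32 _ (fun τ ↦ 2 * etaQuotient 32 (expFn [(4, -2), (8, 4), (16, 2), (32, -4)]) τ)
    (mdifferentiable_etaQuotient 32 _) ?_ (fun γ hγ τ ↦ X_smul ⟨γ, hγ⟩ τ)
    (fun γ hγ τ ↦ by simp only [Y_smul ⟨γ, hγ⟩ τ])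
    (fun γ hγ ↦ isBoundedAtImInfty_X_smul hγ) (fun γ hγ ↦ ?_) hT1
  · exact (mdifferentiable_etaQuotient 32 _).const_smul (2 : ℂ)
  · exact (isBoundedAtImInfty_Y_smul hγ).const_mul_left 2

/-- **(I2b)₃₂ from (T2)₃₂**: `Y′ = −2πi φ₃₂ · (3X² + 4)`. [folklore] -/
theorem deriv_Y_of_tendsto
    (hT2 : Tendsto (fun τ : ℍ ↦ ((2 * π * I)⁻¹ * deriv (etaQuotient 32 (expFn [(4, -2), (8, 4), (16, 2), (32, -4)]) ∘ ofComplex) τ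
      + cuspFormEtaProductThirtyTwo τ * (3 * etaQuotient 32 (expFn [(8, -2), (16, 6), (32, -4)]) τ ^ 2 + 4))
      / Function.Periodic.qParam 1 (τ : ℂ)) atImInfty (𝓝 0)) :
    ∀ τ : ℍ, deriv (etaQuotient 32 (expFn [(4, -2), (8, 4), (16, 2), (32, -4)]) ∘ ofComplex) τ
      = -(2 * π * I * cuspFormEtaProductThirtyTwo τ) * (3 * etaQuotient 32 (expFn [(8, -2), (16, 6), (32, -4)]) τ ^ 2 + 4) := by
  refine deriv_eq_of_tendsto32 _ (fun τ ↦ 3 * etaQuotient 32 (expFn [(8, -2), (16, 6), (32, -4)]) τ ^ 2 + 4)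
    (mdifferentiable_etaQuotient 32 _) ?_ (fun γ hγ τ ↦ Y_smul ⟨γ, hγ⟩ τ)
    (fun γ hγ τ ↦ by simp only [X_smul ⟨γ, hγ⟩ τ])
    (fun γ hγ ↦ isBoundedAtImInfty_Y_smul hγ) (fun γ hγ ↦ ?_) hT2
  · exact (((mdifferentiable_etaQuotient 32 _).pow 2).const_smul (3 : ℂ)).add mdifferentiable_const
  · exact (((isBoundedAtImInfty_X_smul hγ).mul (isBoundedAtImInfty_X_smul hγ)
      |>.const_mul_left 3).add (const_boundedAtFilter atImInfty (4 : ℂ))).congr_left fun τ ↦ by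
        simp only [Pi.mul_apply, Function.const_apply]; ring

/-- **(I1)₃₂ from (I2a), (I2b), (T3)**: `X³ + 4X = Y²` — the derivative of `X³ + 4X − Y²` vanishes identically,
so it is constant on `ℍ`, and it tends to `0` at `i∞`. [folklore] -/
theorem cubic_of_deriv
    (hx : ∀ τ : ℍ, deriv (etaQuotient 32 (expFn [(8, -2), (16, 6), (32, -4)]) ∘ ofComplex) τ
      = -(2 * π * I * cuspFormEtaProductThirtyTwo τ) * (2 * etaQuotient 32 (expFn [(4, -2), (8, 4), (16, 2), (32, -4)]) τ))
    (hy : ∀ τ : ℍ, deriv (etaQuotient 32 (expFn [(4, -2), (8, 4), (16, 2), (32, -4)]) ∘ ofComplex) τ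
      = -(2 * π * I * cuspFormEtaProductThirtyTwo τ) * (3 * etaQuotient 32 (expFn [(8, -2), (16, 6), (32, -4)]) τ ^ 2 + 4))
    (hT3 : Tendsto (fun τ : ℍ ↦ etaQuotient 32 (expFn [(8, -2), (16, 6), (32, -4)]) τ ^ 3 + 4 * etaQuotient 32 (expFn [(8, -2), (16, 6), (32, -4)]) τ
      - etaQuotient 32 (expFn [(4, -2), (8, 4), (16, 2), (32, -4)]) τ ^ 2) atImInfty (𝓝 0)) :
    ∀ τ : ℍ, etaQuotient 32 (expFn [(8, -2), (16, 6), (32, -4)]) τ ^ 3 + 4 * etaQuotient 32 (expFn [(8, -2), (16, 6), (32, -4)]) τ = etaQuotient 32 (expFn [(4, -2), (8, 4), (16, 2), (32, -4)]) τ ^ 2 := by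
  set X : ℍ → ℂ := etaQuotient 32 (expFn [(8, -2), (16, 6), (32, -4)]) with hX
  set Y : ℍ → ℂ := etaQuotient 32 (expFn [(4, -2), (8, 4), (16, 2), (32, -4)]) with hY
  have hXd := UpperHalfPlane.mdifferentiable_iff.mp (mdifferentiable_etaQuotient 32 (expFn [(8, -2), (16, 6), (32, -4)]))
  have hYd := UpperHalfPlane.mdifferentiable_iff.mp (mdifferentiable_etaQuotient 32 (expFn [(4, -2), (8, 4), (16, 2), (32, -4)]))
  have hderiv : ∀ z ∈ {z : ℂ | 0 < z.im}, deriv (fun z : ℂ ↦ (X ∘ ofComplex) z ^ 3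
      + 4 * (X ∘ ofComplex) z - (Y ∘ ofComplex) z ^ 2) z = 0 := by
    intro z hz
    have h1 : HasDerivAt (X ∘ ofComplex) (deriv (X ∘ ofComplex) z) z :=
      ((hXd z hz).differentiableAt (isOpen_upperHalfPlaneSet.mem_nhds hz)).hasDerivAt
    have h2 : HasDerivAt (Y ∘ ofComplex) (deriv (Y ∘ ofComplex) z) z :=
      ((hYd z hz).differentiableAt (isOpen_upperHalfPlaneSet.mem_nhds hz)).hasDerivAt
    have hPd := ((h1.pow 3).add (h1.const_mul 4)).sub (h2.pow 2)
    have hfun : (fun z : ℂ ↦ (X ∘ ofComplex) z ^ 3 + 4 * (X ∘ ofComplex) z - (Y ∘ ofComplex) z ^ 2)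
        = fun x ↦ (X ∘ ofComplex ^ 3 + (fun y ↦ 4 * (X ∘ ofComplex) y) - Y ∘ ofComplex ^ 2) x := by
      funext w
      simp only [Pi.sub_apply, Pi.add_apply, Pi.pow_apply]
    rw [hfun, hPd.deriv]
    have hx' := hx ⟨z, hz⟩
    have hy' := hy ⟨z, hz⟩
    have hcoe : ((⟨z, hz⟩ : ℍ) : ℂ) = z := rfl
    rw [hcoe] at hx' hy'
    simp only [Function.comp_apply, ofComplex_apply_of_im_pos hz]
    rw [hx', hy', show (3 : ℕ) - 1 = 2 from rfl, show (2 : ℕ) - 1 = 1 from rfl]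
    push_cast
    ring
  have hPdiff : DifferentiableOn ℂ (fun z : ℂ ↦ (X ∘ ofComplex) z ^ 3
      + 4 * (X ∘ ofComplex) z - (Y ∘ ofComplex) z ^ 2) {z : ℂ | 0 < z.im} :=
    ((hXd.pow 3).add (hXd.const_mul 4)).sub (hYd.pow 2)
  have hconst : ∀ z ∈ {z : ℂ | 0 < z.im}, ∀ w ∈ {z : ℂ | 0 < z.im},
      (fun z : ℂ ↦ (X ∘ ofComplex) z ^ 3 + 4 * (X ∘ ofComplex) z - (Y ∘ ofComplex) z ^ 2) z
        = (fun z : ℂ ↦ (X ∘ ofComplex) z ^ 3 + 4 * (X ∘ ofComplex) z - (Y ∘ ofComplex) z ^ 2) w :=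
    fun z hz w hw ↦ isOpen_upperHalfPlaneSet.is_const_of_deriv_eq_zero
      convex_setOf_im_pos.isPreconnected hPdiff hderiv hz hw
  intro τ
  have hlim : Tendsto (fun σ : ℍ ↦ X σ ^ 3 + 4 * X σ - Y σ ^ 2) atImInfty
      (𝓝 (X τ ^ 3 + 4 * X τ - Y τ ^ 2)) := by
    refine tendsto_const_nhds.congr fun σ ↦ ?_
    have h := hconst _ τ.im_pos _ σ.im_pos
    simp only [Function.comp_apply, ofComplex_apply] at h
    exact h
  have h0 : X τ ^ 3 + 4 * X τ - Y τ ^ 2 = 0 := tendsto_nhds_unique hlim hT3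
  linear_combination h0

/-- `X₃₂ · q² → 1` at `i∞`. [folklore] -/
theorem tendsto_X_mul_qParam_sq :
    Tendsto (fun τ : ℍ ↦ etaQuotient 32 (expFn [(8, -2), (16, 6), (32, -4)]) τ * Function.Periodic.qParam 1 (τ : ℂ) ^ (2 : ℤ)) atImInfty (𝓝 1) := by
  have h := tendsto_etaQuotient_div_qParam_zpow 32 (expFn [(8, -2), (16, 6), (32, -4)]) (-2) (by decide)
  refine h.congr fun τ ↦ ?_
  rw [zpow_neg, div_inv_eq_mul]

/-- Non-degeneracy: `4X³ + 16X ≠ 0` somewhere (else `X² = −4` is constant, but `X q² → 1` forces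
`X² q⁴ → 1` while `−4q⁴ → 0`). [folklore] -/
theorem exists_X_nondegenerate :
    ∃ τ₀ : ℍ, 4 * etaQuotient 32 (expFn [(8, -2), (16, 6), (32, -4)]) τ₀ ^ 3 - (-16) * etaQuotient 32 (expFn [(8, -2), (16, 6), (32, -4)]) τ₀ - 0 ≠ 0 := by
  by_contra hne
  push Not at hne
  set x : ℍ → ℂ := etaQuotient 32 (expFn [(8, -2), (16, 6), (32, -4)]) with hx
  have hx2 : ∀ τ : ℍ, x τ ^ 2 = -4 := by
    intro τ
    have h0 : x τ * (x τ ^ 2 + 4) = 0 := by linear_combination (1 / 4 : ℂ) * hne τ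
    rcases mul_eq_zero.mp h0 with h | h
    · exact absurd h (etaQuotient_ne_zero 32 _ τ)
    · linear_combination h
  have h1 : Tendsto (fun τ : ℍ ↦ (x τ * Function.Periodic.qParam 1 (τ : ℂ) ^ (2 : ℤ)) ^ 2) atImInfty
      (𝓝 1) := by simpa using tendsto_X_mul_qParam_sq.pow 2
  have h2 : Tendsto (fun τ : ℍ ↦ (x τ * Function.Periodic.qParam 1 (τ : ℂ) ^ (2 : ℤ)) ^ 2) atImInfty
      (𝓝 0) := by
    have h4 := (tendsto_qParam_zpow_atImInfty (m := 4) (by norm_num)).const_mul (-4 : ℂ)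
    rw [mul_zero] at h4
    refine h4.congr fun τ ↦ ?_
    rw [mul_pow, hx2, ← zpow_natCast, ← zpow_mul]
    norm_num
  exact one_ne_zero (tendsto_nhds_unique h1 h2)

/-- **(S2)₃₂ from the two identities (I1)₃₂, (I2a)₃₂**: `Λ(φ₃₂) ⊆ Λ(−16, 0)`. [folklore] -/
theorem periodLatticeLeSquare_of_etaIdentities
    (h1 : ∀ τ : ℍ, etaQuotient 32 (expFn [(8, -2), (16, 6), (32, -4)]) τ ^ 3 + 4 * etaQuotient 32 (expFn [(8, -2), (16, 6), (32, -4)]) τ = etaQuotient 32 (expFn [(4, -2), (8, 4), (16, 2), (32, -4)]) τ ^ 2)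
    (h2 : ∀ τ : ℍ, deriv (etaQuotient 32 (expFn [(8, -2), (16, 6), (32, -4)]) ∘ ofComplex) τ
      = -(2 * π * I * cuspFormEtaProductThirtyTwo τ) * (2 * etaQuotient 32 (expFn [(4, -2), (8, 4), (16, 2), (32, -4)]) τ)) :
    ∃ L₁ : PeriodPair, L₁.g₂ = -16 ∧ L₁.g₃ = 0 ∧
      ∀ z ∈ periodLattice cuspFormEtaProductThirtyTwo, z ∈ L₁.lattice := by
  obtain ⟨L₁, hg2, hg3⟩ := PeriodPair.uniformization_holds (-16) 0 (by norm_num)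
  refine ⟨L₁, hg2, hg3, periodLattice_le_of_deriv_sq cuspFormEtaProductThirtyTwo
    cuspFormEtaProductThirtyTwo_ne_zero L₁ _ (mdifferentiable_etaQuotient 32 _) X_smul ?_
    (by rw [hg2, hg3]; exact exists_X_nondegenerate)⟩
  intro τ
  rw [h2 τ, hg2, hg3]
  have h1' := h1 τ
  linear_combination 4 * (2 * π * I * cuspFormEtaProductThirtyTwo τ) ^ 2 * h1'.symm

/-- **(S2)₃₂ from the three limits (T1)₃₂–(T3)₃₂.** [folklore] -/
theorem periodLatticeLeSquare_of_tendsto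
    (hT1 : Tendsto (fun τ : ℍ ↦ ((2 * π * I)⁻¹ * deriv (etaQuotient 32 (expFn [(8, -2), (16, 6), (32, -4)]) ∘ ofComplex) τ
      + cuspFormEtaProductThirtyTwo τ * (2 * etaQuotient 32 (expFn [(4, -2), (8, 4), (16, 2), (32, -4)]) τ))
      / Function.Periodic.qParam 1 (τ : ℂ)) atImInfty (𝓝 0))
    (hT2 : Tendsto (fun τ : ℍ ↦ ((2 * π * I)⁻¹ * deriv (etaQuotient 32 (expFn [(4, -2), (8, 4), (16, 2), (32, -4)]) ∘ ofComplex) τ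
      + cuspFormEtaProductThirtyTwo τ * (3 * etaQuotient 32 (expFn [(8, -2), (16, 6), (32, -4)]) τ ^ 2 + 4))
      / Function.Periodic.qParam 1 (τ : ℂ)) atImInfty (𝓝 0))
    (hT3 : Tendsto (fun τ : ℍ ↦ etaQuotient 32 (expFn [(8, -2), (16, 6), (32, -4)]) τ ^ 3 + 4 * etaQuotient 32 (expFn [(8, -2), (16, 6), (32, -4)]) τ
      - etaQuotient 32 (expFn [(4, -2), (8, 4), (16, 2), (32, -4)]) τ ^ 2) atImInfty (𝓝 0)) :
    ∃ L₁ : PeriodPair, L₁.g₂ = -16 ∧ L₁.g₃ = 0 ∧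
      ∀ z ∈ periodLattice cuspFormEtaProductThirtyTwo, z ∈ L₁.lattice :=
  periodLatticeLeSquare_of_etaIdentities
    (cubic_of_deriv (deriv_X_of_tendsto hT1) (deriv_Y_of_tendsto hT2) hT3) (deriv_X_of_tendsto hT1)


/-- **`|c| = 1` on `X₀(32)` from the three limits (T1)₃₂–(T3)₃₂**: for every globally minimal `W/ℚ` and every
`X₀(32)`-datum with the lattice clause (the Gaussian squeeze `GaussianSqueezeThirtyTwo` with (S1)₃₂ discharged
by `GaussStableThirtyTwo.gaussStableThirtyTwo`).  No modularity, no CDT, no printed Manin fact. [folklore] -/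
theorem abs_maninConstant_eq_one_thirtyTwo_of_tendsto
    (hT1 : Tendsto (fun τ : ℍ ↦ ((2 * π * I)⁻¹ * deriv (etaQuotient 32 (expFn [(8, -2), (16, 6), (32, -4)]) ∘ ofComplex) τ
      + cuspFormEtaProductThirtyTwo τ * (2 * etaQuotient 32 (expFn [(4, -2), (8, 4), (16, 2), (32, -4)]) τ))
      / Function.Periodic.qParam 1 (τ : ℂ)) atImInfty (𝓝 0))
    (hT2 : Tendsto (fun τ : ℍ ↦ ((2 * π * I)⁻¹ * deriv (etaQuotient 32 (expFn [(4, -2), (8, 4), (16, 2), (32, -4)]) ∘ ofComplex) τ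
      + cuspFormEtaProductThirtyTwo τ * (3 * etaQuotient 32 (expFn [(8, -2), (16, 6), (32, -4)]) τ ^ 2 + 4))
      / Function.Periodic.qParam 1 (τ : ℂ)) atImInfty (𝓝 0))
    (hT3 : Tendsto (fun τ : ℍ ↦ etaQuotient 32 (expFn [(8, -2), (16, 6), (32, -4)]) τ ^ 3 + 4 * etaQuotient 32 (expFn [(8, -2), (16, 6), (32, -4)]) τ
      - etaQuotient 32 (expFn [(4, -2), (8, 4), (16, 2), (32, -4)]) τ ^ 2) atImInfty (𝓝 0))
    (W : WeierstrassCurve ℚ) [W.IsGloballyMinimal] (D : ModularParametrizationData W 32)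
    (hopt : ∀ z ∈ D.L.lattice, ∃ w ∈ periodLattice D.f, z = D.c * w) :
    |D.maninConstant| = 1 :=
  GaussianSqueezeThirtyTwo.abs_maninConstant_eq_one_thirtyTwo_of_periodLattice_le_square
    (periodLatticeLeSquare_of_tendsto hT1 hT2 hT3) W D hopt

end Summit.BirchSwinnertonDyer.BirchSwinnertonDyer.Theorems.ManinLocalTwoThree.EtaIdentityReductionThirtyTwo

end
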